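import Literature.Geometry.Riemannian.ShortGeodesics
import Literature.Geometry.Riemannian.ConvexSublevelShortGeodesics
import Mathlib.Topology.UniformSpace.Dini
import HarnessLib

/-!
# Birkhoff curve shortening of geodesic polygons in a non-trapping convex domain
(Birkhoff / Lusternik–Fet, as in Milnor 1963, §16; Paternain–Salo–Uhlmann 2023, Prop. 3.7.22)

The finite-dimensional curve-shortening process on geodesic `N`-gons with short sides in the
compact domain `D = {ρ ≤ 0}` (strictly convex, non-trapping) of a compact Riemannian manifold:
`Ψ` = `birkhoffStep` (replace every vertex by the midpoint of the following side),
`En` = `polygonEnergy` (`∑ d(xᵢ, xᵢ₊₁)²`), on the admissible polygons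
`{x : Fin N → M | ρ(xᵢ) ≤ 0, d(xᵢ, xᵢ₊₁) ≤ ε₁}` with `ε₁` below the uniform normal radius
`ε(M,g)` and below the convexity speed `ℓ₀` (hypothesis `hstay`, the output of
`IsStrictlyConvexSublevel.exists_pos_forall_isGeodesic`).

* `birkhoffStep_admissible` — `Ψ` preserves admissibility.
* `polygonEnergy_birkhoffStep_le` — `En(Ψ x) ≤ En(x)`;
  `eq_of_polygonEnergy_birkhoffStep_eq` — equality forces equal sides and tight midpoint triangles.
* `forall_eq_of_polygonEnergy_birkhoffStep_eq` — **rigidity**: `En(Ψ x) = En(x)` forces a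
  constant polygon — otherwise the polygon is a CLOSED GEODESIC in `D` (no corners, by
  `velocity_geodesicSegment_one_eq_geodesicJoin`), i.e. a trapped geodesic, contradicting
  `IsNonTrappingSublevel` (this is the only place where non-trapping is used).
* `exists_forall_polygonEnergy_iterate_lt` — **uniform decay**: for every `η > 0` some iterate
  `Ψ^m` has energy `< η` on ALL admissible polygons (pointwise decay to `0` by compactness +
  rigidity, then Dini's theorem).

No definitions, no named facts (D-0026).

## References

* J. Milnor, *Morse theory*, Princeton 1963, §16. [Milnor1963]
* G. P. Paternain, M. Salo, G. Uhlmann, *Geometric inverse problems*, CUP 2023, Prop. 3.7.22,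
  Remark 3.7.23. [PaternainSaloUhlmann2023]
-/

noncomputable section

open Bundle Set Filter Function Metric Manifold
open scoped Manifold ContDiff Topology ENNReal NNReal

namespace Literature.Geometry.Riemannian

open Literature.Geometry.Lorentzian
open Literature.Geometry.Lorentzian.PseudoRiemannianMetric

variable {E : Type*} [NormedAddCommGroup E] [NormedSpace ℝ E] {H : Type*} [TopologicalSpace H]
  {I : ModelWithCorners ℝ E H} {M : Type*} [TopologicalSpace M] [ChartedSpace H M]
  [IsManifold I ∞ M] {n : ℕ∞ω} [FiniteDimensional ℝ E] [CompleteSpace E] [T2Space M]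
  [I.Boundaryless] [CompactSpace M]
  {g : PseudoRiemannianMetric I n E (TangentSpace I : M → Type _)} [g.HasLeviCivita]
  {ρ : M → ℝ} {N : ℕ} [NeZero N] {ε₁ ℓ₀ : ℝ}

/-! ### Admissible polygons and one Birkhoff step -/

/-- **A short geodesic segment with endpoints in `D = {ρ ≤ 0}` lies in `D`**, in terms of
`geodesicSegment` (from the speed hypothesis `hstay`, the output of
`IsStrictlyConvexSublevel.exists_pos_forall_isGeodesic`). [cite: PaternainSaloUhlmann2023, Lemma 3.1.12] -/
theorem geodesicSegment_mem_of_le (hn : (∞ : ℕ∞ω) ≤ n) (hg : g.IsRiemannian)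
    (hstay : ∀ γ : ℝ → M, IsGeodesic g.leviCivita γ →
      g.val (γ 0) (velocity I γ 0) (velocity I γ 0) < ℓ₀ ^ 2 →
      ρ (γ 0) ≤ 0 → ρ (γ 1) ≤ 0 → ∀ t ∈ Icc (0 : ℝ) 1, ρ (γ t) ≤ 0)
    (hε₁ℓ : ε₁ < ℓ₀) (hε₁ε : ε₁ < uniformNormalRadius g hn hg) (hε₁ : 0 ≤ ε₁)
    {x y : M} (hx : ρ x ≤ 0) (hy : ρ y ≤ 0) (hxy : g.edist hg x y ≤ ENNReal.ofReal ε₁)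
    {t : ℝ} (ht : t ∈ Icc (0 : ℝ) 1) : ρ (geodesicSegment g hn hg x y t) ≤ 0 := by
  have hε := uniformNormalRadius_pos hn hg
  have hxy' : g.edist hg x y < ENNReal.ofReal (uniformNormalRadius g hn hg) :=
    lt_of_le_of_lt hxy ((ENNReal.ofReal_lt_ofReal_iff hε).2 hε₁ε)
  refine hstay _ (isGeodesic_geodesicSegment hn hg x y) ?_ (by rwa [geodesicSegment_zero])
    (by rwa [geodesicSegment_one hn hg hxy']) t ht
  rw [geodesicSegment_zero, velocity_geodesicSegment_zero]
  have h1 : Real.sqrt (g.val x (geodesicJoin g hn hg x y) (geodesicJoin g hn hg x y)) ≤ ε₁ := by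
    rw [sqrt_geodesicJoin_eq_toReal hn hg hxy']
    have h := ENNReal.toReal_mono ENNReal.ofReal_ne_top hxy
    rwa [ENNReal.toReal_ofReal hε₁] at h
  have h2 : Real.sqrt (g.val x (geodesicJoin g hn hg x y) (geodesicJoin g hn hg x y)) < ℓ₀ :=
    lt_of_le_of_lt h1 hε₁ℓ
  have hℓ₀ : 0 < ℓ₀ := lt_of_le_of_lt hε₁ hε₁ℓ
  rw [Real.sqrt_lt' hℓ₀] at h2
  exact h2

/-- **The Birkhoff step preserves admissibility**: if all vertices lie in `D` and all sides have
length `≤ ε₁`, the same holds for the midpoint polygon (midpoints of short segments with endpoints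
in `D` lie in `D`; `d(mᵢ, mᵢ₊₁) ≤ d(mᵢ, xᵢ₊₁) + d(xᵢ₊₁, mᵢ₊₁) = ½ ℓᵢ + ½ ℓᵢ₊₁ ≤ ε₁`).
[cite: Milnor1963, §16 (p. 88–89)] -/
theorem birkhoffStep_admissible (hn : (∞ : ℕ∞ω) ≤ n) (hg : g.IsRiemannian)
    (hstay : ∀ γ : ℝ → M, IsGeodesic g.leviCivita γ →
      g.val (γ 0) (velocity I γ 0) (velocity I γ 0) < ℓ₀ ^ 2 →
      ρ (γ 0) ≤ 0 → ρ (γ 1) ≤ 0 → ∀ t ∈ Icc (0 : ℝ) 1, ρ (γ t) ≤ 0)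
    (hε₁ℓ : ε₁ < ℓ₀) (hε₁ε : ε₁ < uniformNormalRadius g hn hg) (hε₁ : 0 ≤ ε₁)
    {x : Fin N → M} (hx : ∀ i, ρ (x i) ≤ 0 ∧ g.edist hg (x i) (x (i + 1)) ≤ ENNReal.ofReal ε₁) :
    ∀ i, ρ (birkhoffStep g hn hg x i) ≤ 0 ∧
      g.edist hg (birkhoffStep g hn hg x i) (birkhoffStep g hn hg x (i + 1)) ≤ ENNReal.ofReal ε₁ := by
  have hε := uniformNormalRadius_pos hn hg
  have hlt : ∀ i, g.edist hg (x i) (x (i + 1)) < ENNReal.ofReal (uniformNormalRadius g hn hg) :=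
    fun i ↦ lt_of_le_of_lt (hx i).2 ((ENNReal.ofReal_lt_ofReal_iff hε).2 hε₁ε)
  have hhalf : (1 / 2 : ℝ) ∈ Icc (0 : ℝ) 1 := ⟨by norm_num, by norm_num⟩
  intro i
  refine ⟨geodesicSegment_mem_of_le hn hg hstay hε₁ℓ hε₁ε hε₁ (hx i).1 (hx (i + 1)).1 (hx i).2 hhalf, ?_⟩
  -- `d(mᵢ, mᵢ₊₁) ≤ ½ ℓᵢ + ½ ℓᵢ₊₁`
  have h1 : g.edist hg (birkhoffStep g hn hg x i) (x (i + 1)) =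
      ENNReal.ofReal (1 - 1 / 2) * g.edist hg (x i) (x (i + 1)) :=
    (edist_geodesicSegment_eq hn hg (hlt i) hhalf).2
  have h2 : g.edist hg (x (i + 1)) (birkhoffStep g hn hg x (i + 1)) =
      ENNReal.ofReal (1 / 2) * g.edist hg (x (i + 1)) (x (i + 1 + 1)) :=
    (edist_geodesicSegment_eq hn hg (hlt (i + 1)) hhalf).1
  calc g.edist hg (birkhoffStep g hn hg x i) (birkhoffStep g hn hg x (i + 1))
      ≤ g.edist hg (birkhoffStep g hn hg x i) (x (i + 1)) +
        g.edist hg (x (i + 1)) (birkhoffStep g hn hg x (i + 1)) := edist_triangle hg _ _ _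
    _ = ENNReal.ofReal (1 / 2) * g.edist hg (x i) (x (i + 1)) +
        ENNReal.ofReal (1 / 2) * g.edist hg (x (i + 1)) (x (i + 1 + 1)) := by
          rw [h1, h2]; norm_num
    _ ≤ ENNReal.ofReal (1 / 2) * ENNReal.ofReal ε₁ + ENNReal.ofReal (1 / 2) * ENNReal.ofReal ε₁ := by
          gcongr
          · exact (hx i).2
          · exact (hx (i + 1)).2
    _ = ENNReal.ofReal ε₁ := by
          rw [← two_mul, ← mul_assoc, ← ENNReal.ofReal_ofNat 2, ← ENNReal.ofReal_mul (by norm_num)]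
          norm_num

/-- Iterates of the Birkhoff step preserve admissibility. [cite: Milnor1963, §16 (p. 88–89)] -/
theorem birkhoffStep_iterate_admissible (hn : (∞ : ℕ∞ω) ≤ n) (hg : g.IsRiemannian)
    (hstay : ∀ γ : ℝ → M, IsGeodesic g.leviCivita γ →
      g.val (γ 0) (velocity I γ 0) (velocity I γ 0) < ℓ₀ ^ 2 →
      ρ (γ 0) ≤ 0 → ρ (γ 1) ≤ 0 → ∀ t ∈ Icc (0 : ℝ) 1, ρ (γ t) ≤ 0)
    (hε₁ℓ : ε₁ < ℓ₀) (hε₁ε : ε₁ < uniformNormalRadius g hn hg) (hε₁ : 0 ≤ ε₁) (m : ℕ)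
    {x : Fin N → M} (hx : ∀ i, ρ (x i) ≤ 0 ∧ g.edist hg (x i) (x (i + 1)) ≤ ENNReal.ofReal ε₁) :
    ∀ i, ρ ((birkhoffStep g hn hg)^[m] x i) ≤ 0 ∧
      g.edist hg ((birkhoffStep g hn hg)^[m] x i) ((birkhoffStep g hn hg)^[m] x (i + 1)) ≤
        ENNReal.ofReal ε₁ := by
  induction m with
  | zero => exact hx
  | succ m ih =>
    rw [Function.iterate_succ_apply']
    exact birkhoffStep_admissible hn hg hstay hε₁ℓ hε₁ε hε₁ ih

/-! ### The energy decreases under a Birkhoff step -/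

section Energy

variable {x : Fin N → M}

/-- Side lengths as real numbers. [folklore] -/
theorem toReal_edist_birkhoffStep_le (hn : (∞ : ℕ∞ω) ≤ n) (hg : g.IsRiemannian) (hε₁ε : ε₁ < uniformNormalRadius g hn hg)
    (hx : ∀ i, g.edist hg (x i) (x (i + 1)) ≤ ENNReal.ofReal ε₁) (i : Fin N) :
    (g.edist hg (birkhoffStep g hn hg x i) (birkhoffStep g hn hg x (i + 1))).toReal ≤
      (g.edist hg (x i) (x (i + 1))).toReal / 2 + (g.edist hg (x (i + 1)) (x (i + 1 + 1))).toReal / 2 := by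
  have hε := uniformNormalRadius_pos hn hg
  have hlt : ∀ i, g.edist hg (x i) (x (i + 1)) < ENNReal.ofReal (uniformNormalRadius g hn hg) :=
    fun i ↦ lt_of_le_of_lt (hx i) ((ENNReal.ofReal_lt_ofReal_iff hε).2 hε₁ε)
  have hfin : ∀ i, g.edist hg (x i) (x (i + 1)) ≠ ⊤ := fun i ↦ ne_top_of_lt (hlt i)
  have hhalf : (1 / 2 : ℝ) ∈ Icc (0 : ℝ) 1 := ⟨by norm_num, by norm_num⟩
  have h1 : g.edist hg (birkhoffStep g hn hg x i) (x (i + 1)) =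
      ENNReal.ofReal (1 - 1 / 2) * g.edist hg (x i) (x (i + 1)) :=
    (edist_geodesicSegment_eq hn hg (hlt i) hhalf).2
  have h2 : g.edist hg (x (i + 1)) (birkhoffStep g hn hg x (i + 1)) =
      ENNReal.ofReal (1 / 2) * g.edist hg (x (i + 1)) (x (i + 1 + 1)) :=
    (edist_geodesicSegment_eq hn hg (hlt (i + 1)) hhalf).1
  have htri : g.edist hg (birkhoffStep g hn hg x i) (birkhoffStep g hn hg x (i + 1)) ≤
      ENNReal.ofReal (1 / 2) * g.edist hg (x i) (x (i + 1)) +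
        ENNReal.ofReal (1 / 2) * g.edist hg (x (i + 1)) (x (i + 1 + 1)) := by
    calc g.edist hg (birkhoffStep g hn hg x i) (birkhoffStep g hn hg x (i + 1))
        ≤ g.edist hg (birkhoffStep g hn hg x i) (x (i + 1)) +
          g.edist hg (x (i + 1)) (birkhoffStep g hn hg x (i + 1)) := edist_triangle hg _ _ _
      _ = _ := by rw [h1, h2]; norm_num
  have hA : ENNReal.ofReal (1 / 2) * g.edist hg (x i) (x (i + 1)) ≠ ⊤ :=
    ENNReal.mul_ne_top ENNReal.ofReal_ne_top (hfin i)
  have hB : ENNReal.ofReal (1 / 2) * g.edist hg (x (i + 1)) (x (i + 1 + 1)) ≠ ⊤ :=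
    ENNReal.mul_ne_top ENNReal.ofReal_ne_top (hfin (i + 1))
  have h := ENNReal.toReal_mono (ENNReal.add_ne_top.2 ⟨hA, hB⟩) htri
  rw [ENNReal.toReal_add hA hB, ENNReal.toReal_mul, ENNReal.toReal_mul,
    ENNReal.toReal_ofReal (by norm_num)] at h
  linarith

omit [NeZero N] in
/-- Reindexing a cyclic sum: `∑ᵢ f (i + 1) = ∑ᵢ f i` on `Fin N`. [folklore] -/
theorem sum_add_one_eq [NeZero N] (f : Fin N → ℝ) : ∑ i, f (i + 1) = ∑ i, f i :=
  Fintype.sum_equiv (Equiv.addRight 1) _ _ fun _ ↦ rfl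

/-- **The energy does not increase under a Birkhoff step**:
`∑ d(mᵢ, mᵢ₊₁)² ≤ ∑ (½ℓᵢ + ½ℓᵢ₊₁)² ≤ ∑ (½ℓᵢ² + ½ℓᵢ₊₁²) = ∑ ℓᵢ²` (Birkhoff; Milnor 1963, §16:
the energy of the broken geodesic decreases under the deformation). [cite: Milnor1963, §16 (p. 88–89)] -/
theorem polygonEnergy_birkhoffStep_le (hn : (∞ : ℕ∞ω) ≤ n) (hg : g.IsRiemannian) (hε₁ε : ε₁ < uniformNormalRadius g hn hg)
    (hx : ∀ i, g.edist hg (x i) (x (i + 1)) ≤ ENNReal.ofReal ε₁) :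
    polygonEnergy g hg (birkhoffStep g hn hg x) ≤ polygonEnergy g hg x := by
  set ℓ : Fin N → ℝ := fun i ↦ (g.edist hg (x i) (x (i + 1))).toReal with hℓ
  have hℓ0 : ∀ i, 0 ≤ ℓ i := fun i ↦ ENNReal.toReal_nonneg
  have hstep : ∀ i, (g.edist hg (birkhoffStep g hn hg x i) (birkhoffStep g hn hg x (i + 1))).toReal ^ 2 ≤
      ℓ i ^ 2 / 2 + ℓ (i + 1) ^ 2 / 2 := by
    intro i
    have h := toReal_edist_birkhoffStep_le hn hg hε₁ε hx i
    have h0 : 0 ≤ (g.edist hg (birkhoffStep g hn hg x i) (birkhoffStep g hn hg x (i + 1))).toReal :=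
      ENNReal.toReal_nonneg
    have h1 : (g.edist hg (birkhoffStep g hn hg x i) (birkhoffStep g hn hg x (i + 1))).toReal ^ 2 ≤
        (ℓ i / 2 + ℓ (i + 1) / 2) ^ 2 := pow_le_pow_left₀ h0 h 2
    have h2 : (ℓ i / 2 + ℓ (i + 1) / 2) ^ 2 ≤ ℓ i ^ 2 / 2 + ℓ (i + 1) ^ 2 / 2 := by
      nlinarith [sq_nonneg (ℓ i - ℓ (i + 1))]
    exact h1.trans h2
  calc polygonEnergy g hg (birkhoffStep g hn hg x)
      = ∑ i, (g.edist hg (birkhoffStep g hn hg x i) (birkhoffStep g hn hg x (i + 1))).toReal ^ 2 := rfl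
    _ ≤ ∑ i, (ℓ i ^ 2 / 2 + ℓ (i + 1) ^ 2 / 2) := Finset.sum_le_sum fun i _ ↦ hstep i
    _ = (∑ i, ℓ i ^ 2) / 2 + (∑ i, ℓ (i + 1) ^ 2) / 2 := by
          rw [Finset.sum_add_distrib, Finset.sum_div, Finset.sum_div]
    _ = ∑ i, ℓ i ^ 2 := by rw [sum_add_one_eq (fun i ↦ ℓ i ^ 2)]; ring
    _ = polygonEnergy g hg x := rfl

/-- **Equality in the energy inequality forces all sides to have the same length and all
midpoint triangles to be tight**: if `En(Ψ x) = En(x)` then `ℓᵢ = ℓᵢ₊₁` and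
`d(mᵢ, mᵢ₊₁) = ½ℓᵢ + ½ℓᵢ₊₁` for every `i`. [cite: Milnor1963, §16 (p. 88–89)] -/
theorem eq_of_polygonEnergy_birkhoffStep_eq (hn : (∞ : ℕ∞ω) ≤ n) (hg : g.IsRiemannian) (hε₁ε : ε₁ < uniformNormalRadius g hn hg)
    (hx : ∀ i, g.edist hg (x i) (x (i + 1)) ≤ ENNReal.ofReal ε₁)
    (heq : polygonEnergy g hg (birkhoffStep g hn hg x) = polygonEnergy g hg x) :
    ∀ i, (g.edist hg (x i) (x (i + 1))).toReal = (g.edist hg (x (i + 1)) (x (i + 1 + 1))).toReal ∧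
      (g.edist hg (birkhoffStep g hn hg x i) (birkhoffStep g hn hg x (i + 1))).toReal =
        (g.edist hg (x i) (x (i + 1))).toReal / 2 + (g.edist hg (x (i + 1)) (x (i + 1 + 1))).toReal / 2 := by
  set ℓ : Fin N → ℝ := fun i ↦ (g.edist hg (x i) (x (i + 1))).toReal with hℓ
  set e : Fin N → ℝ := fun i ↦
    (g.edist hg (birkhoffStep g hn hg x i) (birkhoffStep g hn hg x (i + 1))).toReal with he
  have hℓ0 : ∀ i, 0 ≤ ℓ i := fun i ↦ ENNReal.toReal_nonneg
  have he0 : ∀ i, 0 ≤ e i := fun i ↦ ENNReal.toReal_nonneg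
  have hle : ∀ i, e i ≤ ℓ i / 2 + ℓ (i + 1) / 2 := fun i ↦ toReal_edist_birkhoffStep_le hn hg hε₁ε hx i
  -- the termwise slack is nonnegative and sums to zero
  set slack : Fin N → ℝ := fun i ↦ ℓ i ^ 2 / 2 + ℓ (i + 1) ^ 2 / 2 - e i ^ 2 with hslack
  have hslack0 : ∀ i, 0 ≤ slack i := by
    intro i
    have h1 : e i ^ 2 ≤ (ℓ i / 2 + ℓ (i + 1) / 2) ^ 2 := pow_le_pow_left₀ (he0 i) (hle i) 2
    have h2 : (ℓ i / 2 + ℓ (i + 1) / 2) ^ 2 ≤ ℓ i ^ 2 / 2 + ℓ (i + 1) ^ 2 / 2 := by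
      nlinarith [sq_nonneg (ℓ i - ℓ (i + 1))]
    show 0 ≤ ℓ i ^ 2 / 2 + ℓ (i + 1) ^ 2 / 2 - e i ^ 2
    linarith
  have hsum : ∑ i, slack i = 0 := by
    have hE1 : polygonEnergy g hg (birkhoffStep g hn hg x) = ∑ i, e i ^ 2 := rfl
    have hE0 : polygonEnergy g hg x = ∑ i, ℓ i ^ 2 := rfl
    have h1 : ∑ i, slack i = (∑ i, ℓ i ^ 2) / 2 + (∑ i, ℓ (i + 1) ^ 2) / 2 - ∑ i, e i ^ 2 := by
      simp only [hslack, Finset.sum_sub_distrib, Finset.sum_add_distrib, Finset.sum_div]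
    rw [h1, sum_add_one_eq (fun i ↦ ℓ i ^ 2), ← hE1, ← hE0, heq]
    ring
  have hslack_eq : ∀ i, slack i = 0 := fun i ↦
    (Finset.sum_eq_zero_iff_of_nonneg (fun i _ ↦ hslack0 i)).1 hsum i (Finset.mem_univ i)
  intro i
  have h0 := hslack_eq i
  have h1 : e i ^ 2 ≤ (ℓ i / 2 + ℓ (i + 1) / 2) ^ 2 := pow_le_pow_left₀ (he0 i) (hle i) 2
  have h2 : (ℓ i / 2 + ℓ (i + 1) / 2) ^ 2 ≤ ℓ i ^ 2 / 2 + ℓ (i + 1) ^ 2 / 2 := by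
    nlinarith [sq_nonneg (ℓ i - ℓ (i + 1))]
  have h3 : ℓ i ^ 2 / 2 + ℓ (i + 1) ^ 2 / 2 - e i ^ 2 = 0 := h0
  have h4 : (ℓ i - ℓ (i + 1)) ^ 2 = 0 := by nlinarith [sq_nonneg (ℓ i - ℓ (i + 1))]
  have h5 : ℓ i = ℓ (i + 1) := by
    have := pow_eq_zero_iff (n := 2) (by norm_num) |>.1 h4
    linarith
  refine ⟨h5, ?_⟩
  -- `e i = ℓ i / 2 + ℓ (i+1) / 2`
  have h6 : e i ^ 2 = (ℓ i / 2 + ℓ (i + 1) / 2) ^ 2 := by nlinarith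
  have h7 : 0 ≤ ℓ i / 2 + ℓ (i + 1) / 2 := by linarith [hℓ0 i, hℓ0 (i + 1)]
  exact (pow_left_inj₀ (he0 i) h7 two_ne_zero).1 h6

end Energy

/-! ### Equality forces a closed geodesic, hence (non-trapping) a constant polygon -/

section Rigidity

/-- Side lengths of a cyclic polygon with `ℓᵢ = ℓᵢ₊₁` are all equal. [folklore] -/
theorem eq_zero_of_forall_succ_eq {f : Fin N → ℝ} (h : ∀ i, f i = f (i + 1)) : ∀ i, f i = f 0 := by
  intro i
  obtain ⟨k, hk⟩ := i
  induction k with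
  | zero => rfl
  | succ k ih =>
    have hk' : k < N := Nat.lt_of_succ_lt hk
    have h1 : (⟨k + 1, hk⟩ : Fin N) = ⟨k, hk'⟩ + 1 := by
      apply Fin.ext
      rw [Fin.val_add]
      simp [Nat.mod_eq_of_lt hk]
    rw [h1, ← h ⟨k, hk'⟩]
    exact ih hk'

/-- **A polygon in `D` whose energy is not decreased by the Birkhoff step is constant**
(Birkhoff / Lusternik–Fet, as in Milnor 1963, §16, combined with the non-trapping hypothesis):
equality forces all sides to have the same length `λ` and every midpoint triangle
`mᵢ, xᵢ₊₁, mᵢ₊₁` to be tight; if `λ > 0` the broken geodesic is smooth at every vertex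
(`velocity_geodesicSegment_one_eq_geodesicJoin`), hence a closed geodesic lying in `D`
(`geodesicSegment_mem_of_le`) with non-zero velocity — a trapped geodesic, contradicting
`IsNonTrappingSublevel`. So `λ = 0`. [cite: PaternainSaloUhlmann2023, Prop. 3.7.22 and Remark 3.7.23] -/
theorem forall_eq_of_polygonEnergy_birkhoffStep_eq (hn : (∞ : ℕ∞ω) ≤ n) (hg : g.IsRiemannian) (hnt : IsNonTrappingSublevel g ρ)
    (hstay : ∀ γ : ℝ → M, IsGeodesic g.leviCivita γ →
      g.val (γ 0) (velocity I γ 0) (velocity I γ 0) < ℓ₀ ^ 2 →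
      ρ (γ 0) ≤ 0 → ρ (γ 1) ≤ 0 → ∀ t ∈ Icc (0 : ℝ) 1, ρ (γ t) ≤ 0)
    (hε₁ℓ : ε₁ < ℓ₀) (hε₁ε : ε₁ < uniformNormalRadius g hn hg) (hε₁ : 0 ≤ ε₁)
    {x : Fin N → M} (hx : ∀ i, ρ (x i) ≤ 0 ∧ g.edist hg (x i) (x (i + 1)) ≤ ENNReal.ofReal ε₁)
    (heq : polygonEnergy g hg (birkhoffStep g hn hg x) = polygonEnergy g hg x) :
    ∀ i, x i = x 0 := by
  haveI := contMDiffCovariantDerivative_leviCivita_one g hn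
  haveI : Fact (1 ≤ n) := ⟨le_trans (by exact_mod_cast le_top) hn⟩
  have hc := hopfRinow_compact_geodesicallyComplete hn hg
  have hε := uniformNormalRadius_pos hn hg
  set ε := uniformNormalRadius g hn hg with hε_def
  have hlt : ∀ i, g.edist hg (x i) (x (i + 1)) < ENNReal.ofReal ε :=
    fun i ↦ lt_of_le_of_lt (hx i).2 ((ENNReal.ofReal_lt_ofReal_iff hε).2 hε₁ε)
  have hfin : ∀ i, g.edist hg (x i) (x (i + 1)) ≠ ⊤ := fun i ↦ ne_top_of_lt (hlt i)
  have hhalf : (1 / 2 : ℝ) ∈ Icc (0 : ℝ) 1 := ⟨by norm_num, by norm_num⟩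
  obtain hE := eq_of_polygonEnergy_birkhoffStep_eq hn hg hε₁ε (fun i ↦ (hx i).2) heq
  set ℓ : Fin N → ℝ := fun i ↦ (g.edist hg (x i) (x (i + 1))).toReal with hℓ_def
  have hℓeq : ∀ i, ℓ i = ℓ 0 := eq_zero_of_forall_succ_eq fun i ↦ (hE i).1
  set lam := ℓ 0 with hlam_def
  have hdist : ∀ i, g.edist hg (x i) (x (i + 1)) = ENNReal.ofReal lam := fun i ↦ by
    rw [← hℓeq i, hℓ_def, ENNReal.ofReal_toReal (hfin i)]
  have hlam0 : 0 ≤ lam := ENNReal.toReal_nonneg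
  rcases hlam0.eq_or_lt with hzero | hpos
  · -- all sides vanish
    have hsucc : ∀ i, x (i + 1) = x i := fun i ↦ by
      have h : g.edist hg (x i) (x (i + 1)) = 0 := by rw [hdist i, ← hzero, ENNReal.ofReal_zero]
      exact ((edist_eq_zero_iff hg).1 h).symm
    intro i
    obtain ⟨k, hk⟩ := i
    induction k with
    | zero => rfl
    | succ k ih =>
      have hk' : k < N := Nat.lt_of_succ_lt hk
      have h1 : (⟨k + 1, hk⟩ : Fin N) = ⟨k, hk'⟩ + 1 := by
        apply Fin.ext
        rw [Fin.val_add]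
        simp [Nat.mod_eq_of_lt hk]
      rw [h1, hsucc]
      exact ih hk'
  · -- a closed geodesic: contradiction with non-trapping
    exfalso
    have hlamε : lam < ε := by
      have h := ENNReal.toReal_mono ENNReal.ofReal_ne_top (hx 0).2
      rw [ENNReal.toReal_ofReal hε₁] at h
      exact lt_of_le_of_lt h hε₁ε
    -- notation for the segments and midpoints
    set S : Fin N → ℝ → M := fun i ↦ geodesicSegment g hn hg (x i) (x (i + 1)) with hS
    set m : Fin N → M := birkhoffStep g hn hg x with hm
    have hm_eq : ∀ i, m i = S i (1 / 2) := fun i ↦ rfl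
    -- the midpoint triangles are tight, with legs `λ / 2`
    have hleg1 : ∀ i, g.edist hg (m i) (x (i + 1)) = ENNReal.ofReal (lam / 2) := fun i ↦ by
      rw [hm_eq, (edist_geodesicSegment_eq hn hg (hlt i) hhalf).2, hdist i,
        ← ENNReal.ofReal_mul (by norm_num)]
      congr 1; ring
    have hleg2 : ∀ i, g.edist hg (x (i + 1)) (m (i + 1)) = ENNReal.ofReal (lam / 2) := fun i ↦ by
      rw [hm_eq, (edist_geodesicSegment_eq hn hg (hlt (i + 1)) hhalf).1, hdist (i + 1),
        ← ENNReal.ofReal_mul (by norm_num)]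
      congr 1; ring
    have htight : ∀ i, g.edist hg (m i) (m (i + 1)) =
        g.edist hg (m i) (x (i + 1)) + g.edist hg (x (i + 1)) (m (i + 1)) := fun i ↦ by
      have h1 : (g.edist hg (m i) (m (i + 1))).toReal = ℓ i / 2 + ℓ (i + 1) / 2 := (hE i).2
      simp only [hℓeq] at h1
      have hfin' : g.edist hg (m i) (m (i + 1)) ≠ ⊤ := by
        refine ne_top_of_le_ne_top ?_ (edist_triangle hg (m i) (x (i + 1)) (m (i + 1)))
        rw [hleg1, hleg2]
        exact ENNReal.add_ne_top.2 ⟨ENNReal.ofReal_ne_top, ENNReal.ofReal_ne_top⟩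
      rw [hleg1, hleg2, ← ENNReal.ofReal_add (by linarith) (by linarith),
        ← ENNReal.ofReal_toReal hfin', h1]
    -- no corners: the polygon is `C¹` at every vertex
    have hsmooth : ∀ i, velocity I (S i) 1 = geodesicJoin g hn hg (x (i + 1)) (x (i + 1 + 1)) := by
      intro i
      have hpq : g.edist hg (m i) (x (i + 1)) < ENNReal.ofReal ε := by
        rw [hleg1]; exact (ENNReal.ofReal_lt_ofReal_iff hε).2 (by linarith)
      have hqr : g.edist hg (x (i + 1)) (m (i + 1)) < ENNReal.ofReal ε := by
        rw [hleg2]; exact (ENNReal.ofReal_lt_ofReal_iff hε).2 (by linarith)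
      have hposd : 0 < g.edist hg (m i) (x (i + 1)) := by
        rw [hleg1]; exact ENNReal.ofReal_pos.2 (by linarith)
      have heqd : g.edist hg (m i) (x (i + 1)) = g.edist hg (x (i + 1)) (m (i + 1)) := by
        rw [hleg1, hleg2]
      have hG3 := velocity_geodesicSegment_one_eq_geodesicJoin hn hg hpq hqr hposd heqd (htight i)
      -- left side: the second half of `S i`, reparametrised
      have hJm : geodesicJoin g hn hg (m i) (x (i + 1)) = (1 - 1 / 2 : ℝ) • velocity I (S i) (1 / 2) :=
        geodesicJoin_geodesicSegment_right hn hg (hlt i) hhalf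
      have hleft : ∀ s, geodesicSegment g hn hg (m i) (x (i + 1)) s = S i (1 / 2 * s + 1 / 2) := by
        intro s
        rw [geodesicSegment_def, hJm, show (1 - 1 / 2 : ℝ) = 1 / 2 by norm_num]
        show maximalGeodesic g.leviCivita (S i (1 / 2)) ((1 / 2 : ℝ) • velocity I (S i) (1 / 2)) s =
          S i (1 / 2 * s + 1 / 2)
        rw [maximalGeodesic_smul hc]
        show maximalGeodesic g.leviCivita (maximalGeodesic g.leviCivita (x i) (geodesicJoin g hn hg (x i) (x (i + 1))) (1 / 2))
          (velocity I (maximalGeodesic g.leviCivita (x i) (geodesicJoin g hn hg (x i) (x (i + 1)))) (1 / 2))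
          (1 / 2 * s) = maximalGeodesic g.leviCivita (x i) (geodesicJoin g hn hg (x i) (x (i + 1))) (1 / 2 * s + 1 / 2)
        rw [maximalGeodesic_velocity_apply hc]
      have hvel : velocity I (geodesicSegment g hn hg (m i) (x (i + 1))) 1 = (1 / 2 : ℝ) • velocity I (S i) 1 := by
        rw [velocity_congr_of_forall (γ := fun s ↦ S i (1 / 2 * s + 1 / 2))
          (γ' := geodesicSegment g hn hg (m i) (x (i + 1))) hleft 1, velocity_comp_affine,
          show (1 / 2 : ℝ) * 1 + 1 / 2 = 1 by norm_num]
      -- right side: half the next connecting vector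
      have hJr : geodesicJoin g hn hg (x (i + 1)) (m (i + 1)) =
          (1 / 2 : ℝ) • geodesicJoin g hn hg (x (i + 1)) (x (i + 1 + 1)) :=
        geodesicJoin_left_geodesicSegment hn hg (hlt (i + 1)) hhalf
      rw [hvel, hJr] at hG3
      exact smul_right_injective E (by norm_num : (1 / 2 : ℝ) ≠ 0) hG3
    -- the closed geodesic `γ = S 0`
    set γ : ℝ → M := S 0 with hγ_def
    have hγgeo : IsGeodesic g.leviCivita γ := isGeodesic_geodesicSegment hn hg _ _
    -- `S (i + 1) u = S i (u + 1)`
    have hshift : ∀ i u, S (i + 1) u = S i (u + 1) := by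
      intro i u
      have h1 : IsGeodesic g.leviCivita (fun u ↦ S i (u + 1)) := (isGeodesic_geodesicSegment hn hg _ _).translate 1
      have h2 : tangentLift I (fun u ↦ S i (u + 1)) 0 =
          (⟨x (i + 1), geodesicJoin g hn hg (x (i + 1)) (x (i + 1 + 1))⟩ : TangentBundle I M) := by
        have hb : S i (0 + 1) = x (i + 1) := by rw [zero_add]; exact geodesicSegment_one hn hg (hlt i)
        have hv : velocity I (fun u ↦ S i (u + 1)) 0 = geodesicJoin g hn hg (x (i + 1)) (x (i + 1 + 1)) := by
          rw [velocity_translate, zero_add, hsmooth i]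
        exact TotalSpace.ext hb (heq_of_eq hv)
      have h3 := h1.eq_maximalGeodesic h2
      exact (congrFun h3 u).symm
    -- `γ t = S k (t - k)` for all `k : ℕ`
    have hofNat_succ : ∀ k : ℕ, Fin.ofNat N (k + 1) = Fin.ofNat N k + 1 := fun k ↦ by
      apply Fin.ext
      rw [Fin.val_add, Fin.val_ofNat, Fin.val_ofNat, Fin.val_one', Nat.add_mod]
    have hper : ∀ k : ℕ, ∀ t, γ t = S (Fin.ofNat N k) (t - k) := by
      intro k
      induction k with
      | zero =>
        intro t
        have h0 : Fin.ofNat N 0 = 0 := Fin.ext (by rw [Fin.val_ofNat, Nat.zero_mod, Fin.val_zero])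
        rw [h0, Nat.cast_zero, sub_zero]
      | succ k ih =>
        intro t
        rw [ih t, hofNat_succ, hshift, Nat.cast_succ]
        congr 1; ring
    -- `γ` stays in `D` for `t ≥ 0`
    have hD : ∀ t : ℝ, 0 ≤ t → ρ (γ t) ≤ 0 := by
      intro t ht
      set k := ⌊t⌋₊ with hk
      have hs : t - k ∈ Icc (0 : ℝ) 1 :=
        ⟨sub_nonneg.2 (Nat.floor_le ht), by have := Nat.lt_floor_add_one t; rw [← hk] at this; linarith⟩
      rw [hper k t]
      exact geodesicSegment_mem_of_le hn hg hstay hε₁ℓ hε₁ε hε₁ (hx _).1 (hx _).1 (hx _).2 hs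
    -- but it starts in `D` with non-zero velocity: a trapped geodesic
    have h0 : ρ (γ 0) ≤ 0 := by
      have h := hD 0 le_rfl
      exact h
    have hv0 : velocity I γ 0 ≠ 0 := by
      rw [hγ_def, hS]
      show velocity I (geodesicSegment g hn hg (x 0) (x (0 + 1))) 0 ≠ 0
      rw [velocity_geodesicSegment_zero]
      intro hJ
      have hJ' : geodesicJoin g hn hg (x 0) (x (0 + 1)) = (0 : TangentSpace I (x 0)) := hJ
      have h := sqrt_geodesicJoin_eq_toReal hn hg (hlt 0)
      rw [hdist 0, ENNReal.toReal_ofReal hpos.le, hJ'] at h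
      simp at h
      linarith
    obtain ⟨t, ht, hρt⟩ := hnt γ hγgeo h0 hv0
    exact absurd (hD t ht.le) (not_le.2 hρt)

end Rigidity

/-! ### Uniform decay of the energy under iteration (compactness and Dini's theorem) -/

section Dini

omit [CompleteSpace E] [I.Boundaryless] [g.HasLeviCivita] in
/-- The set of admissible polygons is compact. [folklore] -/
theorem isCompact_setOf_admissible (hg : g.IsRiemannian) (hρc : Continuous ρ) :
    IsCompact {x : Fin N → M | ∀ i, ρ (x i) ≤ 0 ∧ g.edist hg (x i) (x (i + 1)) ≤ ENNReal.ofReal ε₁} := by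
  have hclosed : IsClosed {x : Fin N → M | ∀ i, ρ (x i) ≤ 0 ∧
      g.edist hg (x i) (x (i + 1)) ≤ ENNReal.ofReal ε₁} := by
    have h : {x : Fin N → M | ∀ i, ρ (x i) ≤ 0 ∧ g.edist hg (x i) (x (i + 1)) ≤ ENNReal.ofReal ε₁} =
        ⋂ i, ({x | ρ (x i) ≤ 0} ∩ {x | g.edist hg (x i) (x (i + 1)) ≤ ENNReal.ofReal ε₁}) := by
      ext x; simp
    rw [h]
    refine isClosed_iInter fun i ↦ IsClosed.inter ?_ ?_
    · exact isClosed_le (hρc.comp (continuous_apply i)) continuous_const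
    · have h1 : Continuous fun x : Fin N → M ↦ (x i, x (i + 1)) :=
        (continuous_apply i).prodMk (continuous_apply (i + 1))
      exact isClosed_le ((PseudoRiemannianMetric.continuous_edist hg).comp h1) continuous_const
  exact hclosed.isCompact

/-- The Birkhoff step is continuous on polygons with short sides. [cite: Milnor1963, §16 (p. 88–89)] -/
theorem continuousOn_birkhoffStep (hn : (∞ : ℕ∞ω) ≤ n) (hg : g.IsRiemannian) :
    ContinuousOn (birkhoffStep g hn hg)
      {x : Fin N → M | ∀ i, g.edist hg (x i) (x (i + 1)) < ENNReal.ofReal (uniformNormalRadius g hn hg)} := by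
  refine continuousOn_pi.2 fun i ↦ ?_
  have h := continuousOn_geodesicSegment hn hg
  have h1 : Continuous fun x : Fin N → M ↦ ((x i, x (i + 1)), (1 / 2 : ℝ)) :=
    ((continuous_apply i).prodMk (continuous_apply (i + 1))).prodMk continuous_const
  exact h.comp h1.continuousOn fun x hx ↦ ⟨hx i, mem_univ _⟩

omit [CompleteSpace E] [I.Boundaryless] [g.HasLeviCivita] in
/-- The energy is continuous on polygons with sides of finite length. [folklore] -/
theorem continuousOn_polygonEnergy (hg : g.IsRiemannian) :
    ContinuousOn (polygonEnergy g hg) {x : Fin N → M | ∀ i, g.edist hg (x i) (x (i + 1)) ≠ ⊤} := by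
  refine continuousOn_finsetSum _ fun i _ ↦ ?_
  have h0 : Continuous fun x : Fin N → M ↦ (x i, x (i + 1)) :=
    (continuous_apply i).prodMk (continuous_apply (i + 1))
  have h1 : Continuous fun x : Fin N → M ↦ g.edist hg (x i) (x (i + 1)) :=
    (PseudoRiemannianMetric.continuous_edist hg).comp h0
  have h2 : ContinuousOn (fun x : Fin N → M ↦ (g.edist hg (x i) (x (i + 1))).toReal)
      {x : Fin N → M | ∀ i, g.edist hg (x i) (x (i + 1)) ≠ ⊤} :=
    ENNReal.continuousOn_toReal.comp h1.continuousOn fun x hx ↦ hx i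
  exact h2.pow 2

/-- **Uniform decay of the energy under iterated Birkhoff steps** (the compactness step of the
Lusternik–Fet / Birkhoff argument; Milnor 1963, §16 uses the analogous finite-dimensional
compactness of broken geodesics of bounded energy): on the compact set of admissible polygons in
`D` (vertices in `{ρ ≤ 0}`, sides `≤ ε₁`) the energies of the iterates `Ψ^m x` decrease pointwise
to `0` — a limit polygon `x_∞` of a subsequence has `En(Ψ x_∞) = En(x_∞)`, hence is constant
(`forall_eq_of_polygonEnergy_birkhoffStep_eq`, this is where non-trapping enters) — and therefore,
by Dini's theorem, uniformly: for every `η > 0` some iterate `Ψ^m` has energy `< η` on ALL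
admissible polygons. [cite: PaternainSaloUhlmann2023, Prop. 3.7.22 and Remark 3.7.23] -/
theorem exists_forall_polygonEnergy_iterate_lt (hn : (∞ : ℕ∞ω) ≤ n) (hg : g.IsRiemannian) (hρc : Continuous ρ) (hnt : IsNonTrappingSublevel g ρ)
    (hstay : ∀ γ : ℝ → M, IsGeodesic g.leviCivita γ →
      g.val (γ 0) (velocity I γ 0) (velocity I γ 0) < ℓ₀ ^ 2 →
      ρ (γ 0) ≤ 0 → ρ (γ 1) ≤ 0 → ∀ t ∈ Icc (0 : ℝ) 1, ρ (γ t) ≤ 0)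
    (hε₁ℓ : ε₁ < ℓ₀) (hε₁ε : ε₁ < uniformNormalRadius g hn hg) (hε₁ : 0 ≤ ε₁) {η : ℝ} (hη : 0 < η) :
    ∃ m : ℕ, ∀ x : Fin N → M, (∀ i, ρ (x i) ≤ 0 ∧ g.edist hg (x i) (x (i + 1)) ≤ ENNReal.ofReal ε₁) →
      polygonEnergy g hg ((birkhoffStep g hn hg)^[m] x) < η := by
  have hε := uniformNormalRadius_pos hn hg
  set K : Set (Fin N → M) := {x | ∀ i, ρ (x i) ≤ 0 ∧ g.edist hg (x i) (x (i + 1)) ≤ ENNReal.ofReal ε₁}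
    with hK_def
  have hK : IsCompact K := isCompact_setOf_admissible hg hρc
  set Ψ := birkhoffStep g hn hg (N := N) with hΨ_def
  have hmaps : MapsTo Ψ K K := fun x hx ↦ birkhoffStep_admissible hn hg hstay hε₁ℓ hε₁ε hε₁ hx
  have hmaps_it : ∀ m, MapsTo (Ψ^[m]) K K := fun m ↦ hmaps.iterate m
  have hKlt : K ⊆ {x : Fin N → M | ∀ i, g.edist hg (x i) (x (i + 1)) <
      ENNReal.ofReal (uniformNormalRadius g hn hg)} := fun x hx i ↦
    lt_of_le_of_lt (hx i).2 ((ENNReal.ofReal_lt_ofReal_iff hε).2 hε₁ε)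
  have hKfin : K ⊆ {x : Fin N → M | ∀ i, g.edist hg (x i) (x (i + 1)) ≠ ⊤} := fun x hx i ↦
    ne_top_of_lt (hKlt hx i)
  have hΨc : ContinuousOn Ψ K := (continuousOn_birkhoffStep hn hg).mono hKlt
  have hΨc_it : ∀ m, ContinuousOn (Ψ^[m]) K := by
    intro m
    induction m with
    | zero => exact continuousOn_id
    | succ m ih =>
      rw [Function.iterate_succ']
      exact hΨc.comp ih (hmaps_it m)
  have hEc : ContinuousOn (polygonEnergy g hg) K := (continuousOn_polygonEnergy hg).mono hKfin
  -- the decreasing sequence of continuous functions `F m = En ∘ Ψ^m`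
  set F : ℕ → (Fin N → M) → ℝ := fun m x ↦ polygonEnergy g hg (Ψ^[m] x) with hF_def
  have hFc : ∀ m, ContinuousOn (F m) K := fun m ↦ hEc.comp (hΨc_it m) (hmaps_it m)
  have hFanti : ∀ x ∈ K, Antitone (F · x) := by
    intro x hx
    refine antitone_nat_of_succ_le fun m ↦ ?_
    show polygonEnergy g hg (Ψ^[m + 1] x) ≤ polygonEnergy g hg (Ψ^[m] x)
    rw [Function.iterate_succ_apply']
    exact polygonEnergy_birkhoffStep_le hn hg hε₁ε fun i ↦ ((hmaps_it m hx) i).2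
  have hF0 : ∀ m, ∀ x ∈ K, 0 ≤ F m x := fun m x _ ↦
    Finset.sum_nonneg fun i _ ↦ sq_nonneg _
  -- pointwise convergence to `0`
  have hFlim : ∀ x ∈ K, Tendsto (F · x) atTop (𝓝 0) := by
    intro x hx
    -- the limit `e = inf F · x` exists
    have hbdd : BddBelow (range fun m ↦ F m x) := ⟨0, by rintro _ ⟨m, rfl⟩; exact hF0 m x hx⟩
    have hconv : Tendsto (F · x) atTop (𝓝 (⨅ m, F m x)) := tendsto_atTop_ciInf (hFanti x hx) hbdd
    set e := ⨅ m, F m x with he_def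
    suffices he0 : e = 0 by rwa [he0] at hconv
    -- a convergent subsequence of `Ψ^m x` in the compact `K`
    -- a cluster point `xinf ∈ K` of the orbit `Ψ^m x`
    set u : ℕ → Fin N → M := fun m ↦ Ψ^[m] x with hu
    have huK : map u atTop ≤ 𝓟 K :=
      le_principal_iff.2 (eventually_map.2 (Eventually.of_forall fun m ↦ hmaps_it m hx))
    obtain ⟨xinf, hxinf, hcl⟩ := hK.exists_clusterPt huK
    set G : Filter (Fin N → M) := 𝓝 xinf ⊓ map u atTop with hG
    haveI : NeBot G := hcl.neBot
    have hGK : G ≤ 𝓝[K] xinf := le_inf inf_le_left (inf_le_right.trans huK)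
    have hGu : G ≤ map u atTop := inf_le_right
    -- `En xinf = e`
    have h1 : Tendsto (polygonEnergy g hg) G (𝓝 (polygonEnergy g hg xinf)) :=
      (hEc xinf hxinf).tendsto.mono_left hGK
    have h1' : Tendsto (polygonEnergy g hg) G (𝓝 e) := by
      refine Tendsto.mono_left ?_ hGu
      exact tendsto_map'_iff.2 hconv
    have hEinf : polygonEnergy g hg xinf = e := tendsto_nhds_unique h1 h1'
    -- `En (Ψ xinf) = e`
    have h2 : Tendsto (fun y ↦ polygonEnergy g hg (Ψ y)) G (𝓝 (polygonEnergy g hg (Ψ xinf))) := by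
      have hc2 : ContinuousWithinAt (fun y ↦ polygonEnergy g hg (Ψ y)) K xinf :=
        (hEc (Ψ xinf) (hmaps hxinf)).comp (hΨc xinf hxinf) hmaps
      exact hc2.tendsto.mono_left hGK
    have h2' : Tendsto (fun y ↦ polygonEnergy g hg (Ψ y)) G (𝓝 e) := by
      refine Tendsto.mono_left ?_ hGu
      refine tendsto_map'_iff.2 ?_
      have hshift : Tendsto (fun m ↦ F (m + 1) x) atTop (𝓝 e) := hconv.comp (tendsto_add_atTop_nat 1)
      refine hshift.congr fun m ↦ ?_
      show F (m + 1) x = polygonEnergy g hg (Ψ (Ψ^[m] x))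
      rw [hF_def]
      simp only [Function.iterate_succ_apply']
    have hEPsiinf : polygonEnergy g hg (Ψ xinf) = e := tendsto_nhds_unique h2 h2'
    -- rigidity: `xinf` is a constant polygon, so its energy vanishes
    have hconst := forall_eq_of_polygonEnergy_birkhoffStep_eq hn hg hnt hstay hε₁ℓ hε₁ε hε₁ hxinf
      (hEPsiinf.trans hEinf.symm)
    rw [← hEinf]
    show ∑ i, (g.edist hg (xinf i) (xinf (i + 1))).toReal ^ 2 = 0
    refine Finset.sum_eq_zero fun i _ ↦ ?_
    rw [hconst i, hconst (i + 1), PseudoRiemannianMetric.edist_self hg]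
    simp
  -- Dini
  have hunif := Antitone.tendstoUniformlyOn_of_forall_tendsto hK hFc hFanti continuousOn_const hFlim
  obtain ⟨m, hm⟩ := (Metric.tendstoUniformlyOn_iff.1 hunif η hη).exists
  refine ⟨m, fun x hx ↦ ?_⟩
  have h := hm x hx
  rw [Real.dist_eq, zero_sub, abs_neg, abs_of_nonneg (hF0 m x hx)] at h
  exact h

end Dini

end Literature.Geometry.Riemannian
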